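import Summits.QuantumFields.BalabanUV.T4Continuum.Support.NE7K1LinWalkDelta
import Summits.QuantumFields.BalabanUV.T4Continuum.Support.NE7K1LinWalkPad
import Summits.QuantumFields.BalabanUV.T4Continuum.Support.NE7K1LinWalkFineOpRegion

/-!
# NE7K1LinWalkDeltaRegion — row NE7 (node U5), candidate route HOM, path H1L, cell K1-lin(s): B4's `δG` CLAUSE (1.11)–(1.12) AT `A = 0` IN
# KERNEL — FOR TWO UNIONS OF BIG BLOCKS `Ω ⊂ Ω₀`, `G_k(Ω,0) − G_k(Ω₀,0)` DECAYS GEOMETRICALLY IN THE NUMBER OF `M`-CUBE STEPS FROM `x` THROUGH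
# `Ω₀ ∖ Ω` TO `y`, UNIFORMLY IN THE MESH AND IN THE REGIONS

Lineage `b2b-balaban-t4-ne7-p2` (CRUX PROVER NE7 #2), generation 71; series (RW) file 24 = the instance of file 22 (`NE7K1LinWalkDelta`, the
abstract `δG` clause) on the regions of files 18–19 (`NE7K1LinWalkRegion`, `NE7K1LinWalkFineOpRegion`) through the padded operator of file 23
(`NE7K1LinWalkPad`).  [Balaban1983RegularityDecay] = T. Bałaban,
Commun. Math. Phys. 89 (1983) 571–597: p. 573 (1.11)–(1.12) *"If Ω ⊂ Ω₀, then for δG_k(Ω,Ω₀,A) defined by the equality δG_k(Ω,Ω₀,A) = G_k(Ω,A) −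
G_k(Ω₀,A), we have the inequalities (1.5) and (1.6)"* ⟦(1.9)–(1.10)⟧ *"(with the same restrictions on x, x′) with the additional factor
exp(−δ₀ dist(supp f, Ω^c) − δ₀ dist(supp f′, Ω^c))"*, p. 579 *"The terms with ω such that □_{ω_i} are interior cubes of Ω are the same in both
representations, so they cancel in the difference … we get the first inequality in (2.22) with 2^{d+1} instead of 2^d and with the restriction
n ≥ M^{−1}"* ⟦inf⟧*"_{x₁∈Ω^c}(dist({x,x′},x₁) + dist(x₁, supp f)) − 3"*, p. 581 *"The same inequalities hold for δG_k(Ω,Ω₀,A)"*.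

THE INSTANCE.  Mesh `1∕n` (`n ≥ 1`), cube scale `M ≥ 3` (`W = Mn`), labels `J ∈ Π_μ{0..K_μ}`, two cell sets `C ⊆ C₀ ⊂ ℤ^{d+1}` and the regions
`Ω = reg (Mn) K C ⊆ Ω₀ = reg (Mn) K C₀` (all unions of big blocks in the bounding box, file 18), `a > 0`, `P_Ω = fineOpR n a 0 Ω`,
`P_{Ω₀} = fineOpR n a 0 Ω₀` (B4 (1.6) at `A = 0`, Neumann conditions on `∂Ω` resp. `∂Ω₀`).

* (file 23 `NE7K1LinWalkPad`) THE PADDED OPERATOR `pad Ω Ω₀ P_Ω` on `↥Ω₀` (`P_Ω` on `Ω` ⊕ the identity on `Ω₀ ∖ Ω`): `(pad P)⁻¹ = pad P⁻¹`,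
  coercive with floor `min(σ,1)`, (H-comm) and `CutoffOn` transfer — so file 22 runs for the pair (`pad Ω Ω₀ P_Ω`, `P_{Ω₀}`) on `↥Ω₀`.
* §1 THE ENTRIES OF `fineOpR`: the OFF-DIAGONAL entries do not depend on the region, the diagonal entry is `n²·#(nbrs x ∩ R) + a∕n^{d+1}`
  ⇒ `P_Ω` and `P_{Ω₀}` have THE SAME ENTRY at `(x,y)` whenever `x ≠ y` or all `Ω₀`-neighbours of `x` lie in `Ω` (`fineOpR_apply_eq_of_interior`);
  the INTERIOR labels (complement of `bdryLab`: the `Ω₀`-region of `J` lies in `Ω` together with all `Ω₀`-neighbours) carry the same `S_J × S_J`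
  block (`pad_fineOpR_agree`); a label of `bdryLab` carries a DEFECT SITE `z ∈ Ω₀ ∖ Ω` in its region enlarged by one (`exists_defect`), whence
  the printed length restriction from site distances (`label_sep_of_far_regions`, `label_sep_through`).
* §2 **`fineOpR_inv_sub_inv_entry_decay_region`** — B4 (1.11)–(1.12) ∕ Corollary 2.3 AT `A = 0`: for `3^{d+1}τ < 1` (`τ = NE7K1LinWalkFineOp.tau
  d M a`, the threshold of files 8 ∕ 19, UNCHANGED) and `x, y ∈ Ω` such that EVERY `z ∈ Ω₀ ∖ Ω` admits `N₀ + N₁ ≥ N ≥ 1` with (`N₀ = 0` or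
  `|x_μ − z_μ| ≥ (2N₀+3)Mn + n + 1` for some `μ`) and (`N₁ = 0` or `|z_ν − y_ν| ≥ (2N₁+3)Mn + 2n + 1` for some `ν`):
  `|(G_k(Ω,0) − G_k(Ω₀,0)|_{Ω×Ω})(x,y)| ≤ 2·3^{d+1}σ′⁻¹τ·3^{d+1}(3^{d+1}τ)^{N−1}∕(1 − 3^{d+1}τ)`, `σ′ = min(min(2,a),1)` — file 22's
  `inv_sub_inv_entry_decay` on the pair (`pad Ω Ω₀ P_Ω`, `P_{Ω₀}`) with `Ω₀`'s cut-off system, every hypothesis discharged; the factor `2` is the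
  printed «2^{d+1} instead of 2^d», the hypothesis is the printed «inf over exit points x₁ of dist(x,x₁) + dist(x₁,y)» with `Ω₀ ∖ Ω ⊂ Ω^c` in
  place of `Ω^c` (weaker); `fineOpR_inv_sub_inv_entry_decay_depth` — the form with ONE DEPTH FOR `x` AND ONE FOR `y` (`N₀` steps from `x`
  to `Ω₀ ∖ Ω`, `N₁` from `Ω₀ ∖ Ω` to `y`: the printed factor in `dist(x,Ω^c) + dist(supp f,Ω^c)`); `fineOpR_inv_sub_inv_entry_decay_blockUnion`
  (§3) — the same for `R ⊆ R₀ ⊆ Π_μ[0,(2K_μ+1)Mn)` ANY two unions of `Mn`-blocks, transported along `NE7K1LinWalkRegion.reg_image_blk_eq`.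

HONEST FRAMING: [folklore] assembly; A = 0 only (no background field, no covariant derivative, no gauge group), ONE scale (no multi-scale factor
`M^{−½|ω|}`, no Hölder norms of B4 §3 — the (1.9) version of the clause is NOT typed); crude explicit constants, not optimised; nothing of
Bałaban's beyond (1.6)/(1.8)/(1.11)–(1.12)/(2.2)–(2.13) at A = 0 is touched; no `sorry`.  Census: cell K1-lin(s)'s «template application» —
random-walk half — now includes the `δG` clause at A = 0 for the s = 0 endpoint on every pair of unions of big blocks.  NO letter ∕ tag ∕ size of
NE7 moves; NE7 NOT PRINTED ∕ NOT PROVED; spine 0∕9; FIXED FINITE T⁴, rung (B)+1; NOT infinite volume, NOT mass gap, NOT Clay.  HONEST DEPENDENCY: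
continuum YM on T⁴ ⇐ BetaPertH ∧ nine spine estimates (0/9 proved); BetaPertH ⇐ (D1) ∧ (D4) ∧ CAP+tail; G-an2-4 gates asym, D1 and NE2/3/4.
-/

noncomputable section

open Finset Matrix
open scoped Matrix.Norms.L2Operator

namespace Summit.QuantumFields.BalabanUV.T4Continuum.NE7K1LinWalkDeltaRegion

open NE7K1LinSchurLineForm NE7K1LinWalkParametrix NE7K1LinWalkSmallness NE7K1LinWalkExpansion NE7K1LinWalkCommutator
  NE7K1LinWalkProfile NE7K1LinWalkCubes NE7K1LinWalkBox NE7K1LinWalkFineOp NE7K1LinWalkRegion NE7K1LinWalkFineOpRegion NE7K1LinWalkDelta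
  NE7K1LinWalkPad
open Literature.MathematicalPhysics.QuantumFieldTheory.Balaban1983to89
open Literature.MathematicalPhysics.QuantumFieldTheory.Balaban1983to89.B4Reflection242
open Literature.MathematicalPhysics.QuantumFieldTheory.Balaban1983to89.B4BoxCov237
open Literature.MathematicalPhysics.QuantumFieldTheory.Balaban1983to89.B4Lower18

/-! ### §1 The entries of `fineOpR` on two regions; interior labels; defect sites and the length restriction -/

variable {d : ℕ}

/-- **OFF-DIAGONAL ENTRIES OF `fineOpR` DO NOT SEE THE REGION; THE DIAGONAL ENTRY SEES ONLY THE NEIGHBOURS INSIDE IT**: for `R ⊆ R₀` and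
`x, y ∈ R` with `x ≠ y` or all `R₀`-neighbours of `x` in `R`, `(fineOpR n a m2 R)_{xy} = (fineOpR n a m2 R₀)_{xy}`.
[cite: Balaban1983RegularityDecay, p.572 (1.3)–(1.6) «operators on subsets of the lattice», dictionary] [folklore] -/
theorem fineOpR_apply_eq_of_interior {n : ℕ} {a m2 : ℝ} {R R₀ : Finset (Fin (d + 1) → ℤ)} (hR : R ⊆ R₀) {x y : ↥R₀}
    (hx : x.1 ∈ R) (hy : y.1 ∈ R) (hint : x ≠ y ∨ ∀ z ∈ nbrs x.1, z ∈ R₀ → z ∈ R) :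
    fineOpR n a m2 R ⟨x.1, hx⟩ ⟨y.1, hy⟩ = fineOpR n a m2 R₀ x y := by
  by_cases hxy : x = y
  · subst hxy
    have hint' : ∀ z ∈ nbrs x.1, z ∈ R₀ → z ∈ R := by
      rcases hint with h | h
      · exact absurd rfl h
      · exact h
    have hfilter : (nbrs x.1).filter (fun z => z ∈ R) = (nbrs x.1).filter (fun z => z ∈ R₀) :=
      Finset.filter_congr fun z hz => ⟨fun h => hR h, fun h => hint' z hz h⟩
    simp only [fineOpR, regionOpR, Matrix.of_apply]
    unfold neumannLapR
    rw [hfilter]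
  · have h1 : y.1 ≠ x.1 := fun h => hxy (Subtype.ext h).symm
    simp only [fineOpR, regionOpR, Matrix.of_apply, neumannLapR, diagK, avgK, h1, if_false]

/-- monotonicity of the regions in the cell set. [folklore] -/
theorem reg_mono {C C₀ : Finset (Fin (d + 1) → ℤ)} (W : ℕ) (K : Fin (d + 1) → ℕ) (hC : C ⊆ C₀) : reg W K C ⊆ reg W K C₀ :=
  fun x hx => by
    rw [mem_reg] at hx ⊢
    exact ⟨hx.1, hC hx.2⟩

open Classical in
/-- **THE BOUNDARY LABEL SET `T`** of a pair of site sets `Ω ⊆ Ω₀` (scale `W`, margin `ρ`): the labels whose `Ω₀`-region is NOT interior to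
`Ω` — some site of it lies outside `Ω` or has an `Ω₀`-neighbour outside `Ω` (B4: «at least one □_{ω_i} intersects the boundary ∂Ω»).
[cite: Balaban1983RegularityDecay, p.579 after (2.22), dictionary] [folklore] -/
def bdryLab (W ρ : ℕ) (K : Fin (d + 1) → ℕ) (Ω Ω₀ : Finset (Fin (d + 1) → ℤ)) : Finset (Lab K) :=
  univ.filter fun J => ¬ ∀ y ∈ region Ω₀ W ρ J.1, y.1 ∈ Ω ∧ ∀ z ∈ nbrs y.1, z ∈ Ω₀ → z ∈ Ω

/-- **INTERIOR LABELS CARRY THE SAME REGION BLOCK**: for `J ∉ bdryLab`, the padded `fineOpR` of `Ω` and the `fineOpR` of `Ω₀` agree on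
`S_J × S_J` — the agreement hypothesis of file 22 ∕ of `B4RandomWalkDelta112` («the terms … are the same in both representations») DISCHARGED
at A = 0. [cite: Balaban1983RegularityDecay, p.579 after (2.22), mechanism] [folklore] -/
theorem pad_fineOpR_agree {W ρ : ℕ} (K : Fin (d + 1) → ℕ) {Ω Ω₀ : Finset (Fin (d + 1) → ℤ)} (hΩ : Ω ⊆ Ω₀) (n : ℕ) (a m2 : ℝ)
    {J : Lab K} (hJ : J ∉ bdryLab W ρ K Ω Ω₀) (x : ↥Ω₀) (hx : x ∈ region Ω₀ W ρ J.1) (y : ↥Ω₀) (hy : y ∈ region Ω₀ W ρ J.1) :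
    pad Ω Ω₀ (fineOpR n a m2 Ω) x y = fineOpR n a m2 Ω₀ x y := by
  classical
  simp only [bdryLab, Finset.mem_filter, Finset.mem_univ, true_and, not_not] at hJ
  rw [pad_apply_mem_mem _ (hJ x hx).1 (hJ y hy).1]
  exact fineOpR_apply_eq_of_interior hΩ _ _ (Or.inr (hJ x hx).2)

/-- neighbours are at sup-distance `≤ 1`. [folklore] -/
theorem abs_sub_le_one_of_mem_nbrs {x z : Fin (d + 1) → ℤ} (h : z ∈ nbrs x) (μ : Fin (d + 1)) : |z μ - x μ| ≤ 1 := by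
  have hs := sum_abs_sub_of_mem_nbrs h
  have h1 : |(x μ : ℝ) - z μ| ≤ ∑ ν, |(x ν : ℝ) - z ν| :=
    Finset.single_le_sum (f := fun ν => |(x ν : ℝ) - z ν|) (fun ν _ => abs_nonneg _) (Finset.mem_univ μ)
  rw [hs, abs_sub_comm] at h1
  have h3 : ((|z μ - x μ| : ℤ) : ℝ) ≤ 1 := by push_cast; exact h1
  exact_mod_cast h3

/-- **A BOUNDARY LABEL CARRIES A DEFECT SITE**: for `t ∈ bdryLab` there is `z ∈ Ω₀ ∖ Ω` in the region of `t` enlarged by one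
(`region Ω₀ W (ρ+1) t`). [folklore] -/
theorem exists_defect {W ρ : ℕ} (K : Fin (d + 1) → ℕ) {Ω Ω₀ : Finset (Fin (d + 1) → ℤ)} {t : Lab K} (ht : t ∈ bdryLab W ρ K Ω Ω₀) :
    ∃ z : ↥Ω₀, z.1 ∉ Ω ∧ z ∈ region Ω₀ W (ρ + 1) t.1 := by
  classical
  simp only [bdryLab, Finset.mem_filter, Finset.mem_univ, true_and] at ht
  push Not at ht
  obtain ⟨y, hy, hbad⟩ := ht
  have hyreg := mem_region.1 hy
  by_cases hyΩ : y.1 ∈ Ω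
  · obtain ⟨z, hz, hz₀, hzΩ⟩ := hbad hyΩ
    refine ⟨⟨z, hz₀⟩, hzΩ, mem_region.2 fun μ => ?_⟩
    have h1 := abs_sub_le_one_of_mem_nbrs hz μ
    rw [abs_le] at h1
    obtain ⟨hl, hr⟩ := hyreg μ
    push_cast at hl hr ⊢
    constructor <;> linarith
  · refine ⟨y, hyΩ, mem_region.2 fun μ => ?_⟩
    obtain ⟨hl, hr⟩ := hyreg μ
    push_cast at hl hr ⊢
    constructor <;> linarith

/-- **SEPARATION OF LABELS FROM SEPARATION OF TWO REGION POINTS**: `z` in the region of `J` with margin `ρ₁`, `y` in the region of `J′` with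
margin `ρ₂`, `|z_ν − y_ν| ≥ (2N+3)W + ρ₁ + ρ₂` ⇒ `|J_ν − J′_ν| ≥ N`. [folklore] -/
theorem label_sep_of_far_regions {R : Finset (Fin (d + 1) → ℤ)} {W ρ₁ ρ₂ : ℕ} (hW : 1 ≤ W) {J J' : Fin (d + 1) → ℕ} {z y : ↥R}
    (hz : z ∈ region R W ρ₁ J) (hy : y ∈ region R W ρ₂ J') {N : ℕ} {ν : Fin (d + 1)}
    (hfar : ((2 * N + 3) * W + ρ₁ + ρ₂ : ℕ) ≤ |z.1 ν - y.1 ν|) : (N : ℤ) ≤ |(J ν : ℤ) - J' ν| := by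
  have h1 := (mem_region.1 hz) ν
  have h2 := (mem_region.1 hy) ν
  have hW1 : (1 : ℤ) ≤ W := by exact_mod_cast hW
  push_cast at hfar
  rcases le_or_gt (y.1 ν) (z.1 ν) with hle | hgt
  · rw [abs_of_nonneg (by linarith)] at hfar
    have h3 : (N : ℤ) * W ≤ ((J ν : ℤ) - J' ν) * W := by nlinarith [h1.2, h2.1]
    have h4 : (N : ℤ) ≤ (J ν : ℤ) - J' ν := le_of_mul_le_mul_right h3 (by linarith)
    exact h4.trans (le_abs_self _)
  · rw [abs_of_neg (by linarith)] at hfar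
    have h3 : (N : ℤ) * W ≤ ((J' ν : ℤ) - J ν) * W := by nlinarith [h1.1, h2.2]
    have h4 : (N : ℤ) ≤ (J' ν : ℤ) - J ν := le_of_mul_le_mul_right h3 (by linarith)
    rw [abs_sub_comm]
    exact h4.trans (le_abs_self _)

/-- **THE PRINTED LENGTH RESTRICTION FROM SITE DISTANCES** («n ≥ M⁻¹ inf_{x₁}(dist(x,x₁) + dist(x₁,y)) − 3»): if every defect site
`z ∈ Ω₀ ∖ Ω` admits `N₀ + N₁ ≥ N` with (`N₀ = 0` or `|x_μ − z_μ| ≥ (2N₀+3)W + (ρ+1)` for some `μ`) and (`N₁ = 0` or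
`|z_ν − y_ν| ≥ (2N₁+3)W + (ρ+1) + ρ` for some `ν`), then every label `J` carrying `x`, every boundary label `t` and every label `k` whose
`Ω₀`-region (margin `ρ`) contains `y` satisfy `|J_μ − t_μ| + |t_{μ′} − k_{μ′}| ≥ N` for some `μ, μ′`.
[cite: Balaban1983RegularityDecay, p.579 after (2.22)] [folklore] -/
theorem label_sep_through {W ρ : ℕ} (K : Fin (d + 1) → ℕ) {Ω Ω₀ : Finset (Fin (d + 1) → ℤ)} (hW : 1 ≤ W) (hΩ : Ω ⊆ Ω₀)
    {x y : ↥Ω} {N : ℕ}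
    (hsepT : ∀ z : ↥Ω₀, z.1 ∉ Ω → ∃ N₀ N₁, N ≤ N₀ + N₁ ∧
      (N₀ = 0 ∨ ∃ μ, (((2 * N₀ + 3) * W + (ρ + 1) : ℕ) : ℤ) ≤ |x.1 μ - z.1 μ|) ∧
      (N₁ = 0 ∨ ∃ ν, (((2 * N₁ + 3) * W + (ρ + 1) + ρ : ℕ) : ℤ) ≤ |z.1 ν - y.1 ν|))
    {J t k : Lab K} (hJ : cut W J.1 x.1 ≠ 0) (ht : t ∈ bdryLab W ρ K Ω Ω₀) (hk : incl hΩ y ∈ region Ω₀ W ρ k.1) :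
    ∃ μ μ', (N : ℤ) ≤ |labPos K J μ - labPos K t μ| + |labPos K t μ' - labPos K k μ'| := by
  obtain ⟨z, hzΩ, hzreg⟩ := exists_defect K ht
  obtain ⟨N₀, N₁, hNN, hxz, hzy⟩ := hsepT z hzΩ
  have hx' : cut W J.1 (incl hΩ x).1 ≠ 0 := hJ
  have h1 : ∃ μ, (N₀ : ℤ) ≤ |labPos K J μ - labPos K t μ| := by
    rcases hxz with h0 | ⟨μ, hμ⟩
    · exact ⟨0, by rw [h0, Nat.cast_zero]; exact abs_nonneg _⟩
    · exact ⟨μ, label_sep_of_far hW hx' hzreg (N := N₀) (μ := μ) hμ⟩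
  have h2 : ∃ ν, (N₁ : ℤ) ≤ |labPos K t ν - labPos K k ν| := by
    rcases hzy with h0 | ⟨ν, hν⟩
    · exact ⟨0, by rw [h0, Nat.cast_zero]; exact abs_nonneg _⟩
    · exact ⟨ν, label_sep_of_far_regions hW hzreg hk (N := N₁) (ν := ν) hν⟩
  obtain ⟨μ, hμ⟩ := h1
  obtain ⟨ν, hν⟩ := h2
  have h3 : (N : ℤ) ≤ N₀ + N₁ := by exact_mod_cast hNN
  exact ⟨μ, ν, by linarith⟩

/-! ### §2 B4 (1.11)–(1.12) ∕ Corollary 2.3 at `A = 0`: the `δG` clause on two regions -/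

/-- the data checks of the padded operator on `Ω₀`'s cut-off system: coercivity `σ′ = min(min(2,a),1)`, cut-offs live on their regions,
(H-comm) with the box's constants, and the remainder is small `‖R‖ ≤ 3^{d+1}τ`. [folklore] -/
theorem pad_data {n M : ℕ} (K : Fin (d + 1) → ℕ) {C C₀ : Finset (Fin (d + 1) → ℤ)} (hn : 1 ≤ n) (hM : 3 ≤ M) (hC : C ⊆ C₀)
    {a : ℝ} (ha : 0 < a) :
    (∀ w, min (min 2 a) 1 * (w ⬝ᵥ w) ≤
        w ⬝ᵥ pad (reg (M * n) K C) (reg (M * n) K C₀) (fineOpR n a 0 (reg (M * n) K C)) *ᵥ w) ∧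
      (∀ J, CutoffOn (pad (reg (M * n) K C) (reg (M * n) K C₀) (fineOpR n a 0 (reg (M * n) K C))) (cutG n M K C₀ J)
        (regG n M K C₀ J)) ∧
      (∀ J v, comm (cutG n M K C₀ J) (pad (reg (M * n) K C) (reg (M * n) K C₀) (fineOpR n a 0 (reg (M * n) K C))) *ᵥ v ⬝ᵥ
          comm (cutG n M K C₀ J) (pad (reg (M * n) K C) (reg (M * n) K C₀) (fineOpR n a 0 (reg (M * n) K C))) *ᵥ v ≤
        alpha2 d M * (v ⬝ᵥ pad (reg (M * n) K C) (reg (M * n) K C₀) (fineOpR n a 0 (reg (M * n) K C)) *ᵥ v) +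
          beta2 d M a * (v ⬝ᵥ v)) ∧
      ‖∑ J : Lab K, bPiece (pad (reg (M * n) K C) (reg (M * n) K C₀) (fineOpR n a 0 (reg (M * n) K C))) (cutG n M K C₀ J)
          (indG n M K C₀ J) (regG n M K C₀ J)‖ ≤ (3 : ℝ) ^ (d + 1) * tau d M a := by
  classical
  obtain ⟨hW, hW2, hρ⟩ := scale_facts hn hM
  have hΩ : reg (M * n) K C ⊆ reg (M * n) K C₀ := reg_mono (M * n) K hC
  set Q := pad (reg (M * n) K C) (reg (M * n) K C₀) (fineOpR n a 0 (reg (M * n) K C)) with hQ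
  have hσ2 : 0 < min 2 a := lt_min two_pos ha
  have hQc : ∀ w, min (min 2 a) 1 * (w ⬝ᵥ w) ≤ w ⬝ᵥ Q *ᵥ w :=
    pad_coercive hΩ _ (fineOpR_coercive_region hn ha M K C)
  have hcutQ : ∀ J, CutoffOn Q (cutG n M K C₀ J) (regG n M K C₀ J) := fun J =>
    cutoffOn_pad (cutoffOn_cutG hn K C₀ hW J) fun x y hx hy hxy =>
      fineOpR_apply_eq_of_interior hΩ hx hy (Or.inl hxy)
  have hα : 0 ≤ alpha2 d M := by unfold alpha2; positivity
  have hβ : 0 ≤ beta2 d M a := by unfold beta2; positivity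
  have hcommQ : ∀ J v, comm (cutG n M K C₀ J) Q *ᵥ v ⬝ᵥ comm (cutG n M K C₀ J) Q *ᵥ v ≤
      alpha2 d M * (v ⬝ᵥ Q *ᵥ v) + beta2 d M a * (v ⬝ᵥ v) := fun J v =>
    hcomm_pad hΩ (cutG n M K C₀ J) (cutG n M K C J) (fun x' => rfl) _ hσ2.le (fineOpR_coercive_region hn ha M K C) hα hβ
      (hcomm_cutG hn K C ha hW2 J) v
  refine ⟨hQc, hcutQ, hcommQ, ?_⟩
  have hσ : 0 < min (min 2 a) 1 := lt_min hσ2 one_pos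
  have h := l2_opNorm_remainder_le Q hσ hQc (cutG n M K C₀) (indG n M K C₀) (regG n M K C₀) hcutQ
    (fun J x => (cutG_indG_bounds K C₀ J x).2.2) (fun J x => (cutG_indG_bounds K C₀ J x).2.1) hα hβ hcommQ
    (fun J => count_overlap_le_region K C₀ hρ J) (fun x => (count_cover_le_region K C₀ hρ x).1)
  refine h.trans (le_of_eq ?_)
  have hmin : min (min (min 2 a) 1) 1 = min (min 2 a) 1 := min_eq_left (min_le_right _ _)
  rw [hmin, tau, ← Real.sqrt_sq (by positivity : (0 : ℝ) ≤ (3 : ℝ) ^ (d + 1)), ← Real.sqrt_mul (by positivity)]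
  congr 1; push_cast; ring

/-- **B4 (1.11)–(1.12) ∕ COROLLARY 2.3 AT `A = 0` — THE `δG` CLAUSE ON TWO UNIONS OF BIG BLOCKS, UNIFORMLY IN THE MESH AND THE REGIONS.**
For `n ≥ 1`, `M ≥ 3`, cell sets `C ⊆ C₀` (regions `Ω = reg (Mn) K C ⊆ Ω₀ = reg (Mn) K C₀`), `a > 0`, `3^{d+1}τ < 1`, and `x, y ∈ Ω` such that
EVERY defect site `z ∈ Ω₀ ∖ Ω` admits `N₀ + N₁ ≥ N ≥ 1` with (`N₀ = 0` or `|x_μ − z_μ| ≥ (2N₀+3)Mn + (n+1)` for some `μ`) and (`N₁ = 0` or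
`|z_ν − y_ν| ≥ (2N₁+3)Mn + (n+1) + n` for some `ν`) — the printed «n ≥ M⁻¹ inf_{x₁∈Ω^c}(dist(x,x₁) + dist(x₁,supp f)) − 3», with
`Ω₀ ∖ Ω` for `Ω^c`; `§3` gives the form with one depth for `x` and one for `y` —:
`|G_k(Ω,0)(x,y) − G_k(Ω₀,0)(x,y)| ≤ 2·3^{d+1}·(min(min(2,a),1))⁻¹·τ·3^{d+1}·(3^{d+1}τ)^{N−1}∕(1 − 3^{d+1}τ)` — «2^{d+1} instead of 2^d».
[cite: Balaban1983RegularityDecay, (1.11)–(1.12) p.573, p.579 after (2.22), Corollary 2.3 p.581, case A = 0] [folklore] -/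
theorem fineOpR_inv_sub_inv_entry_decay_region {n M : ℕ} (hn : 1 ≤ n) (hM : 3 ≤ M) (K : Fin (d + 1) → ℕ)
    {C C₀ : Finset (Fin (d + 1) → ℤ)} (hC : C ⊆ C₀) {a : ℝ} (ha : 0 < a) (hsmall : (3 : ℝ) ^ (d + 1) * tau d M a < 1)
    (x y : ↥(reg (M * n) K C)) {N : ℕ} (hN : 1 ≤ N)
    (hsepT : ∀ z : ↥(reg (M * n) K C₀), z.1 ∉ reg (M * n) K C → ∃ N₀ N₁, N ≤ N₀ + N₁ ∧
      (N₀ = 0 ∨ ∃ μ, (((2 * N₀ + 3) * (M * n) + (n + 1) : ℕ) : ℤ) ≤ |x.1 μ - z.1 μ|) ∧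
      (N₁ = 0 ∨ ∃ ν, (((2 * N₁ + 3) * (M * n) + (n + 1) + n : ℕ) : ℤ) ≤ |z.1 ν - y.1 ν|)) :
    |(fineOpR n a 0 (reg (M * n) K C))⁻¹ x y -
        (fineOpR n a 0 (reg (M * n) K C₀))⁻¹ (incl (reg_mono (M * n) K hC) x) (incl (reg_mono (M * n) K hC) y)| ≤
      2 * ((3 : ℝ) ^ (d + 1) * (1 / min (min 2 a) 1) * tau d M a * (3 : ℝ) ^ (d + 1) *
        ((3 : ℝ) ^ (d + 1) * tau d M a) ^ (N - 1) / (1 - (3 : ℝ) ^ (d + 1) * tau d M a)) := by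
  classical
  obtain ⟨hW, hW2, hρ⟩ := scale_facts hn hM
  have hΩ : reg (M * n) K C ⊆ reg (M * n) K C₀ := reg_mono (M * n) K hC
  obtain ⟨hQc, hcutQ, hcommQ, hRQ⟩ := pad_data K hn hM hC ha
  have hσ2 : 0 < min 2 a := lt_min two_pos ha
  have hσ : 0 < min (min 2 a) 1 := lt_min hσ2 one_pos
  have hP₀c : ∀ w, min (min 2 a) 1 * (w ⬝ᵥ w) ≤ w ⬝ᵥ fineOpR n a 0 (reg (M * n) K C₀) *ᵥ w := fun w =>
    (mul_le_mul_of_nonneg_right (min_le_left _ _) (Finset.sum_nonneg fun i _ => mul_self_nonneg _)).trans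
      (fineOpR_coercive_region hn ha M K C₀ w)
  have hα : 0 ≤ alpha2 d M := by unfold alpha2; positivity
  have hβ : 0 ≤ beta2 d M a := by unfold beta2; positivity
  have hmin : min (min (min 2 a) 1) 1 = min (min 2 a) 1 := min_eq_left (min_le_right _ _)
  have hsmall' : (3 : ℝ) ^ (d + 1) * Real.sqrt (alpha2 d M / min (min (min 2 a) 1) 1 +
      beta2 d M a / (min (min (min 2 a) 1) 1) ^ 2) < 1 := by
    rw [hmin]; rw [tau] at hsmall; exact hsmall
  -- the agreement off the boundary labels and the length restriction
  have hagree : ∀ J ∉ bdryLab (M * n) n K (reg (M * n) K C) (reg (M * n) K C₀), ∀ x' ∈ regG n M K C₀ J, ∀ y' ∈ regG n M K C₀ J,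
      pad (reg (M * n) K C) (reg (M * n) K C₀) (fineOpR n a 0 (reg (M * n) K C)) x' y' = fineOpR n a 0 (reg (M * n) K C₀) x' y' :=
    fun J hJ x' hx' y' hy' => pad_fineOpR_agree K hΩ n a 0 hJ x' hx' y' hy'
  have hsepT' : ∀ J, cutG n M K C₀ J (incl hΩ x) ≠ 0 → ∀ t ∈ bdryLab (M * n) n K (reg (M * n) K C) (reg (M * n) K C₀), ∀ k,
      indG n M K C₀ k (incl hΩ y) ≠ 0 → ∃ μ μ', (N : ℤ) ≤ |labPos K J μ - labPos K t μ| + |labPos K t μ' - labPos K k μ'| :=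
    fun J hJ t ht k hk => label_sep_through K hW hΩ hsepT hJ ht (((cutG_indG_bounds K C₀ k (incl hΩ y)).2.2) hk)
  have hmain := inv_sub_inv_entry_decay (labPos K) (labPos_injective K)
    (pad (reg (M * n) K C) (reg (M * n) K C₀) (fineOpR n a 0 (reg (M * n) K C))) (fineOpR n a 0 (reg (M * n) K C₀)) hσ hQc hP₀c
    (cutG n M K C₀) (indG n M K C₀) (regG n M K C₀) (fun J J' hJJ' => disjoint_regG K C₀ hρ hJJ') hcutQ
    (cutoffOn_cutG hn K C₀ hW) (sum_cutG_mul_indG K C₀ hW) zero_le_one (fun J x => (cutG_indG_bounds K C₀ J x).1)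
    (fun J x => (cutG_indG_bounds K C₀ J x).2.2) (fun J x => (cutG_indG_bounds K C₀ J x).2.1) hα hβ hcommQ
    (hcomm_cutG hn K C₀ ha hW2) hsmall' (hRQ.trans_lt hsmall)
    ((l2_opNorm_remainder_region hn hM K C₀ ha).trans_lt hsmall) (bdryLab (M * n) n K (reg (M * n) K C) (reg (M * n) K C₀)) hagree
    (incl hΩ x) (incl hΩ y)
    (count_cover_le_region K C₀ hρ (incl hΩ x)).2 hN hsepT'
  -- read off: the padded inverse at included points is `P_Ω⁻¹`
  have hPinv : fineOpR n a 0 (reg (M * n) K C) * (fineOpR n a 0 (reg (M * n) K C))⁻¹ = 1 :=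
    mul_nonsing_inv _ (isUnit_det_of_coercive _ hσ2 (fineOpR_coercive_region hn ha M K C))
  have hent : ((pad (reg (M * n) K C) (reg (M * n) K C₀) (fineOpR n a 0 (reg (M * n) K C)))⁻¹ -
      (fineOpR n a 0 (reg (M * n) K C₀))⁻¹) (incl hΩ x) (incl hΩ y) =
      (fineOpR n a 0 (reg (M * n) K C))⁻¹ x y - (fineOpR n a 0 (reg (M * n) K C₀))⁻¹ (incl hΩ x) (incl hΩ y) := by
    rw [Matrix.sub_apply, pad_inv hΩ hPinv, pad_incl]
  rw [hent, hmin] at hmain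
  rw [tau]
  refine hmain.trans (le_of_eq ?_)
  push_cast
  ring

/-- **THE (1.12) FORM WITH TWO DEPTHS**: if `x` is `N₀` cube steps deep (`N₀ = 0`, or `|x_μ − z_μ| ≥ (2N₀+3)Mn + (n+1)` for some `μ`, for EVERY
defect site `z ∈ Ω₀ ∖ Ω`) and `y` is `N₁` steps deep (`N₁ = 0`, or `|z_ν − y_ν| ≥ (2N₁+3)Mn + (n+1) + n` for some `ν`, for every `z`), with
`N₀ + N₁ ≥ 1`, then `|G_k(Ω,0)(x,y) − G_k(Ω₀,0)(x,y)| ≤ 2·3^{d+1}σ′⁻¹τ·3^{d+1}·(3^{d+1}τ)^{N₀+N₁−1}∕(1 − 3^{d+1}τ)` — the printed «additional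
factor exp(−δ₀ dist(x, Ω^c) − δ₀ dist(supp f, Ω^c))» in cube steps. [cite: Balaban1983RegularityDecay, (1.12) p.573, Corollary 2.3 p.581, case A = 0] [folklore] -/
theorem fineOpR_inv_sub_inv_entry_decay_depth {n M : ℕ} (hn : 1 ≤ n) (hM : 3 ≤ M) (K : Fin (d + 1) → ℕ)
    {C C₀ : Finset (Fin (d + 1) → ℤ)} (hC : C ⊆ C₀) {a : ℝ} (ha : 0 < a) (hsmall : (3 : ℝ) ^ (d + 1) * tau d M a < 1)
    (x y : ↥(reg (M * n) K C)) {N₀ N₁ : ℕ} (hN : 1 ≤ N₀ + N₁)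
    (hx : N₀ = 0 ∨ ∀ z : ↥(reg (M * n) K C₀), z.1 ∉ reg (M * n) K C →
      ∃ μ, (((2 * N₀ + 3) * (M * n) + (n + 1) : ℕ) : ℤ) ≤ |x.1 μ - z.1 μ|)
    (hy : N₁ = 0 ∨ ∀ z : ↥(reg (M * n) K C₀), z.1 ∉ reg (M * n) K C →
      ∃ ν, (((2 * N₁ + 3) * (M * n) + (n + 1) + n : ℕ) : ℤ) ≤ |z.1 ν - y.1 ν|) :
    |(fineOpR n a 0 (reg (M * n) K C))⁻¹ x y -
        (fineOpR n a 0 (reg (M * n) K C₀))⁻¹ (incl (reg_mono (M * n) K hC) x) (incl (reg_mono (M * n) K hC) y)| ≤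
      2 * ((3 : ℝ) ^ (d + 1) * (1 / min (min 2 a) 1) * tau d M a * (3 : ℝ) ^ (d + 1) *
        ((3 : ℝ) ^ (d + 1) * tau d M a) ^ (N₀ + N₁ - 1) / (1 - (3 : ℝ) ^ (d + 1) * tau d M a)) :=
  fineOpR_inv_sub_inv_entry_decay_region hn hM K hC ha hsmall x y hN fun z hz =>
    ⟨N₀, N₁, le_rfl, hx.imp id fun h => h z hz, hy.imp id fun h => h z hz⟩

/-- **… IN EXPONENTIAL FORM**: if moreover `3^{d+1}τ ≤ e^{−δ}` (`δ > 0`), the bound reads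
`2·3^{d+1}σ′⁻¹τ·3^{d+1}∕(1 − e^{−δ}) · e^{−δ(N₀+N₁−1)}` — the printed exponential factor of (1.12) in cube steps (file 22's `geom_le_exp`).
[cite: Balaban1983RegularityDecay, (1.12) p.573, Corollary 2.3 (2.30) pp.580–581, case A = 0] [folklore] -/
theorem fineOpR_inv_sub_inv_entry_decay_depth_exp {n M : ℕ} (hn : 1 ≤ n) (hM : 3 ≤ M) (K : Fin (d + 1) → ℕ)
    {C C₀ : Finset (Fin (d + 1) → ℤ)} (hC : C ⊆ C₀) {a : ℝ} (ha : 0 < a) {δ : ℝ} (hδ : 0 < δ)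
    (hsmall : (3 : ℝ) ^ (d + 1) * tau d M a ≤ Real.exp (-δ))
    (x y : ↥(reg (M * n) K C)) {N₀ N₁ : ℕ} (hN : 1 ≤ N₀ + N₁)
    (hx : N₀ = 0 ∨ ∀ z : ↥(reg (M * n) K C₀), z.1 ∉ reg (M * n) K C →
      ∃ μ, (((2 * N₀ + 3) * (M * n) + (n + 1) : ℕ) : ℤ) ≤ |x.1 μ - z.1 μ|)
    (hy : N₁ = 0 ∨ ∀ z : ↥(reg (M * n) K C₀), z.1 ∉ reg (M * n) K C →
      ∃ ν, (((2 * N₁ + 3) * (M * n) + (n + 1) + n : ℕ) : ℤ) ≤ |z.1 ν - y.1 ν|) :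
    |(fineOpR n a 0 (reg (M * n) K C))⁻¹ x y -
        (fineOpR n a 0 (reg (M * n) K C₀))⁻¹ (incl (reg_mono (M * n) K hC) x) (incl (reg_mono (M * n) K hC) y)| ≤
      2 * ((3 : ℝ) ^ (d + 1) * (1 / min (min 2 a) 1) * tau d M a * (3 : ℝ) ^ (d + 1) / (1 - Real.exp (-δ)) *
        Real.exp (-(δ * ((N₀ + N₁ - 1 : ℕ) : ℝ)))) := by
  have he1 : Real.exp (-δ) < 1 := Real.exp_lt_one_iff.mpr (neg_lt_zero.mpr hδ)
  have hσ : 0 < min (min 2 a) 1 := lt_min (lt_min two_pos ha) one_pos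
  have hτ : 0 ≤ tau d M a := Real.sqrt_nonneg _
  have h := fineOpR_inv_sub_inv_entry_decay_depth hn hM K hC ha (hsmall.trans_lt he1) x y hN hx hy
  refine h.trans (mul_le_mul_of_nonneg_left ?_ (by norm_num))
  exact geom_le_exp (by positivity) (by positivity) hδ hsmall (N₀ + N₁)

/-! ### §3 The same for two arbitrary unions of big blocks `R ⊆ R₀` (transport along `reg (Mn) K (R.image (blk (Mn))) = R`) -/

/-- entries of a difference of inverses do not see which (equal) finite sets index the matrices. [folklore] -/
theorem inv_sub_inv_transport {n : ℕ} {a : ℝ} {R₁ R₂ S₁ S₂ : Finset (Fin (d + 1) → ℤ)} (h : R₁ = R₂) (h' : S₁ = S₂)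
    (x y : ↥R₂) (x₀ y₀ : ↥S₂) :
    (fineOpR n a 0 R₁)⁻¹ ⟨x.1, h ▸ x.2⟩ ⟨y.1, h ▸ y.2⟩ - (fineOpR n a 0 S₁)⁻¹ ⟨x₀.1, h' ▸ x₀.2⟩ ⟨y₀.1, h' ▸ y₀.2⟩ =
      (fineOpR n a 0 R₂)⁻¹ x y - (fineOpR n a 0 S₂)⁻¹ x₀ y₀ := by
  subst h h'; rfl

/-- **B4 (1.11)–(1.12) AT `A = 0` FOR `G_k(Ω,0) − G_k(Ω₀,0)`, `Ω ⊂ Ω₀` ANY TWO UNIONS OF BIG BLOCKS**: for `R ⊆ R₀ ⊆ Π_μ[0,(2K_μ+1)Mn)` both unions of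
`Mn`-blocks (B4's «Ω a union of big blocks»), `3^{d+1}τ < 1`, and `x, y ∈ R` with the length restriction through the defect sites `z ∈ R₀ ∖ R`
as in `fineOpR_inv_sub_inv_entry_decay_region`:
`|(fineOpR n a 0 R)⁻¹(x,y) − (fineOpR n a 0 R₀)⁻¹(x,y)| ≤ 2·3^{d+1}·(min(min(2,a),1))⁻¹·τ·3^{d+1}·(3^{d+1}τ)^{N−1}∕(1 − 3^{d+1}τ)`.
[cite: Balaban1983RegularityDecay, (1.11)–(1.12) p.573, p.579 after (2.22), Corollary 2.3 p.581, case A = 0] [folklore] -/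
theorem fineOpR_inv_sub_inv_entry_decay_blockUnion {n M : ℕ} (hn : 1 ≤ n) (hM : 3 ≤ M) (K : Fin (d + 1) → ℕ)
    {R R₀ : Finset (Fin (d + 1) → ℤ)} (hR : IsBlockUnion (M * n) R) (hR₀ : IsBlockUnion (M * n) R₀) (hRR₀ : R ⊆ R₀)
    (hR₀box : R₀ ⊆ boxDom (fun μ => (2 * K μ + 1) * (M * n)))
    {a : ℝ} (ha : 0 < a) (hsmall : (3 : ℝ) ^ (d + 1) * tau d M a < 1) (x y : ↥R) {N : ℕ} (hN : 1 ≤ N)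
    (hsepT : ∀ z : ↥R₀, z.1 ∉ R → ∃ N₀ N₁, N ≤ N₀ + N₁ ∧
      (N₀ = 0 ∨ ∃ μ, (((2 * N₀ + 3) * (M * n) + (n + 1) : ℕ) : ℤ) ≤ |x.1 μ - z.1 μ|) ∧
      (N₁ = 0 ∨ ∃ ν, (((2 * N₁ + 3) * (M * n) + (n + 1) + n : ℕ) : ℤ) ≤ |z.1 ν - y.1 ν|)) :
    |(fineOpR n a 0 R)⁻¹ x y - (fineOpR n a 0 R₀)⁻¹ ⟨x.1, hRR₀ x.2⟩ ⟨y.1, hRR₀ y.2⟩| ≤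
      2 * ((3 : ℝ) ^ (d + 1) * (1 / min (min 2 a) 1) * tau d M a * (3 : ℝ) ^ (d + 1) *
        ((3 : ℝ) ^ (d + 1) * tau d M a) ^ (N - 1) / (1 - (3 : ℝ) ^ (d + 1) * tau d M a)) := by
  have e : reg (M * n) K (R.image (blk (M * n))) = R := reg_image_blk_eq hR (hRR₀.trans hR₀box)
  have e₀ : reg (M * n) K (R₀.image (blk (M * n))) = R₀ := reg_image_blk_eq hR₀ hR₀box
  have hC : R.image (blk (M * n)) ⊆ R₀.image (blk (M * n)) := Finset.image_subset_image hRR₀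
  have hx : x.1 ∈ reg (M * n) K (R.image (blk (M * n))) := (Finset.ext_iff.mp e x.1).mpr x.2
  have hy : y.1 ∈ reg (M * n) K (R.image (blk (M * n))) := (Finset.ext_iff.mp e y.1).mpr y.2
  have h := fineOpR_inv_sub_inv_entry_decay_region hn hM K hC ha hsmall ⟨x.1, hx⟩ ⟨y.1, hy⟩ hN
    (fun z hz => hsepT ⟨z.1, (Finset.ext_iff.mp e₀ z.1).mp z.2⟩ (fun h => hz ((Finset.ext_iff.mp e z.1).mpr h)))
  rw [← inv_sub_inv_transport e e₀ x y ⟨x.1, hRR₀ x.2⟩ ⟨y.1, hRR₀ y.2⟩]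
  exact h

end Summit.QuantumFields.BalabanUV.T4Continuum.NE7K1LinWalkDeltaRegion

end
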